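import Summits.BirchSwinnertonDyer.BirchSwinnertonDyer.Theorems.ResidualThetaTransportAtTwoThetaLayerLambdaCongruenceAtTwoDualChainCrossing
import HarnessLib

/-!
# Crux `ThetaLayerLambdaCongruenceAtTwo` (stmt-BirchSwinnertonDyer-20688, route ResidualThetaTransportAtTwo), line
# `birth` v14 — SD floor, kernel road, Hecke clause of IP, brick HA3 «SIDE FORMULA»: the signed crossing vector of a dual walk at the
# class of the edge of `g` is HALF the sum, over `u ∈ Γ₀(N)`, of the side changes of the walk's endpoints with respect to the translated
# edges `u·g` (width seat bsd-wall-rtt-p3-w3 g11; `--supports stmt-BirchSwinnertonDyer-20688 --as helper`; closes nothing)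

HONEST FRAMING. Elementary THEOREMS on lists of matrices, the coset space `SL₂(ℤ)/Γ₀(N)` and finitely supported sums over `Γ₀(N)`
(`finsum`); no definition; nothing about any curve or form is asserted; BSD is not proved by any of this.

WHY (memo `Cruxes/ThetaLayerLambdaCongruenceAtTwo/Lines/birth-sd2-hecke-adjoint.md`, step (C)). w2's crossing vector
`vec(E)(q) = Σ_{h∈E} [h⁻¹Γ₀ = q] − [(hS)⁻¹Γ₀ = q]` (`…DualChain`) is a finite list sum; the Hecke-adjointness computation needs it as a sum over
the GROUP: `2·vec(E)(g⁻¹Γ₀) = Σ'_{u∈Γ₀(N)} (G₁((ug)⁻¹k₂) − G₁((ug)⁻¹k₁))` for a dual walk `E` from the triangle of `k₁` to the triangle of `k₂`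
(`two_mul_dualChainVec_eq_finsum`), where `G₁` is the triangle side function of `…DualChainAcyclic` — «the number of `Γ₀`-translates of the
edge of `g` separating the two end triangles, with signs» — together with the finiteness of the summand's support
(`finite_support_sideDiff`). Ingredients: the OPEN-walk net crossing identity `Σ_{h∈E} ([h = ±f] − [hS = ±f]) = G₁(f⁻¹k₂) − G₁(f⁻¹k₁)`
(`dualChain_netCrossing_eq`, as in w2's closed case) and `Σ'_u [h = ±ug] = 2·[h⁻¹Γ₀ = g⁻¹Γ₀]` (`finsum_indicator_eq`).

References: [Manin1972] §1.5; [Merel1995Homologie] §1.2–1.3 (intersection numbers as sums over the group).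
-/

set_option autoImplicit false

noncomputable section

-- justification: the `Summit.BirchSwinnertonDyer.BirchSwinnertonDyer.…` path repeats a component (route-file convention)
set_option linter.dupNamespace false

open scoped Classical MatrixGroups

open CongruenceSubgroup Matrix.SpecialLinearGroup ModularGroup
open Literature.NumberTheory.EllipticCurves.ModularForms

namespace Summit.BirchSwinnertonDyer.BirchSwinnertonDyer.Theorems.ThetaLayerLambdaCongruenceAtTwo

section SideFormula

variable {N : ℕ}

/-- **Net crossing of an OPEN dual walk with one edge.** For a dual walk `E` from the triangle of `k₁` to the triangle of `k₂` and any
`f ∈ SL₂(ℤ)`: `Σ_{h∈E} ([h = ±f] − [hS = ±f]) = G₁(f⁻¹k₂) − G₁(f⁻¹k₁)` (telescoping with the side function of the edge of `f`; the closed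
case is `dualChain_closed_netCrossing_eq_zero`). [cite: Manin1972, §1.5] -/
theorem dualChain_netCrossing_eq (k₁ k₂ : SL(2, ℤ)) (E : List SL(2, ℤ))
    (hE : ∀ {A : Type} [AddCommGroup A] (G : SL(2, ℤ) → A),
      (∀ x, G (x * (S * T⁻¹)) = G x) → (∀ x, G (-x) = G x) → (E.map fun h ↦ G h - G (h * S)).sum = G k₂ - G k₁)
    (f : SL(2, ℤ)) :
    (E.map fun h ↦ (if (h = f ∨ h = -f) then (1 : ℤ) else 0) - (if (h * S = f ∨ h * S = -f) then (1 : ℤ) else 0)).sum =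
      (if (0 < (f⁻¹ * k₂) 0 0 * (f⁻¹ * k₂) 1 0 ∨ 0 < (f⁻¹ * k₂) 0 1 * (f⁻¹ * k₂) 1 1 ∨ 0 < ((f⁻¹ * k₂) 0 0 + (f⁻¹ * k₂) 0 1) * ((f⁻¹ * k₂) 1 0 + (f⁻¹ * k₂) 1 1)) then (1 : ℤ) else 0) -
      (if (0 < (f⁻¹ * k₁) 0 0 * (f⁻¹ * k₁) 1 0 ∨ 0 < (f⁻¹ * k₁) 0 1 * (f⁻¹ * k₁) 1 1 ∨ 0 < ((f⁻¹ * k₁) 0 0 + (f⁻¹ * k₁) 0 1) * ((f⁻¹ * k₁) 1 0 + (f⁻¹ * k₁) 1 1)) then (1 : ℤ) else 0) := by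
  let G : SL(2, ℤ) → ℤ := fun h ↦
    if (0 < (f⁻¹ * h) 0 0 * (f⁻¹ * h) 1 0 ∨ 0 < (f⁻¹ * h) 0 1 * (f⁻¹ * h) 1 1 ∨
      0 < ((f⁻¹ * h) 0 0 + (f⁻¹ * h) 0 1) * ((f⁻¹ * h) 1 0 + (f⁻¹ * h) 1 1)) then 1 else 0
  have hGdef : ∀ h, G h = if (0 < (f⁻¹ * h) 0 0 * (f⁻¹ * h) 1 0 ∨ 0 < (f⁻¹ * h) 0 1 * (f⁻¹ * h) 1 1 ∨
      0 < ((f⁻¹ * h) 0 0 + (f⁻¹ * h) 0 1) * ((f⁻¹ * h) 1 0 + (f⁻¹ * h) 1 1)) then 1 else 0 := fun h ↦ rfl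
  have hτ : ∀ x, G (x * (S * T⁻¹)) = G x := fun x ↦ by
    rw [hGdef, hGdef, ← mul_assoc]
    exact side_mul_tau (f⁻¹ * x)
  have hneg : ∀ x, G (-x) = G x := fun x ↦ by
    rw [hGdef, hGdef, mul_neg]
    exact side_neg (f⁻¹ * x)
  have key := hE G hτ hneg
  have e : (E.map fun h ↦ (if (h = f ∨ h = -f) then (1 : ℤ) else 0) - (if (h * S = f ∨ h * S = -f) then (1 : ℤ) else 0)) =
      E.map fun h ↦ G h - G (h * S) := by
    refine List.map_congr_left fun h _ ↦ ?_
    have e1 : (f⁻¹ * h = 1 ∨ f⁻¹ * h = -1) ↔ (h = f ∨ h = -f) := by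
      rw [inv_mul_eq_one, inv_mul_eq_iff_eq_mul, mul_neg_one]
      exact or_congr eq_comm Iff.rfl
    have e2 : (f⁻¹ * h * S = 1 ∨ f⁻¹ * h * S = -1) ↔ (h * S = f ∨ h * S = -f) := by
      rw [mul_assoc, inv_mul_eq_one, inv_mul_eq_iff_eq_mul, mul_neg_one]
      exact or_congr eq_comm Iff.rfl
    rw [hGdef, hGdef, ← mul_assoc, side_sub_side_mul_S (f⁻¹ * h), if_congr e1 rfl rfl, if_congr e2 rfl rfl]
  rw [e, key]

/-- `−x ∈ Γ₀(N) ↔ x ∈ Γ₀(N)`. [folklore] -/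
theorem neg_mem_Gamma0_iff (x : SL(2, ℤ)) : -x ∈ Gamma0 N ↔ x ∈ Gamma0 N := by
  rw [Gamma0_mem, Gamma0_mem]
  simp

/-- **Counting translates**: `Σ'_{u∈Γ₀(N)} [h = ug ∨ h = −ug] = 2·[h⁻¹Γ₀(N) = g⁻¹Γ₀(N)]` — the translates `ug` of the edge of `g` that coincide
with the edge of `h` up to sign are `u = ±hg⁻¹`, present iff `hg⁻¹ ∈ Γ₀(N)`. [folklore] -/
theorem finsum_indicator_eq (h g : SL(2, ℤ)) :
    ∑ᶠ u : Gamma0 N, (if (h = (u : SL(2, ℤ)) * g ∨ h = -((u : SL(2, ℤ)) * g)) then (1 : ℤ) else 0) =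
      2 * (if (((h⁻¹ : SL(2, ℤ)) : Gamma0Coset N) = ((g⁻¹ : SL(2, ℤ)) : Gamma0Coset N)) then (1 : ℤ) else 0) := by
  have hcoset : (((h⁻¹ : SL(2, ℤ)) : Gamma0Coset N) = ((g⁻¹ : SL(2, ℤ)) : Gamma0Coset N)) ↔ h * g⁻¹ ∈ Gamma0 N := by
    rw [QuotientGroup.eq, inv_inv]
  by_cases hm : h * g⁻¹ ∈ Gamma0 N
  · rw [if_pos (hcoset.mpr hm)]
    let u₁ : Gamma0 N := ⟨h * g⁻¹, hm⟩
    let u₂ : Gamma0 N := ⟨-(h * g⁻¹), (neg_mem_Gamma0_iff _).mpr hm⟩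
    have hne : u₁ ≠ u₂ := by
      intro heq
      -- `x = -x` is impossible in `SL₂(ℤ)` (cf. `SL_ne_neg_self` in `HeckeOperatorsAdjointProofs`, not imported here)
      have hx := congrArg (fun u : Gamma0 N ↦ (u : SL(2, ℤ))) heq
      simp only [u₁, u₂] at hx
      set x : SL(2, ℤ) := h * g⁻¹ with hxdef
      have h00 : x 0 0 = 0 := by
        have := congrArg (fun y : SL(2, ℤ) ↦ y 0 0) hx
        simp only [Matrix.SpecialLinearGroup.coe_neg, Matrix.neg_apply] at this; linarith
      have h01 : x 0 1 = 0 := by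
        have := congrArg (fun y : SL(2, ℤ) ↦ y 0 1) hx
        simp only [Matrix.SpecialLinearGroup.coe_neg, Matrix.neg_apply] at this; linarith
      have hdet := Matrix.det_fin_two x.1
      rw [x.2] at hdet
      have : (1 : ℤ) = 0 := by rw [hdet]; simp [h00, h01]
      exact one_ne_zero this
    rw [finsum_eq_sum_of_support_subset (s := {u₁, u₂})]
    · rw [Finset.sum_pair hne]
      have e1 : h = (u₁ : SL(2, ℤ)) * g := by simp [u₁]
      have e2 : h = -((u₂ : SL(2, ℤ)) * g) := by simp [u₂]
      rw [if_pos (Or.inl e1), if_pos (Or.inr e2)]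
      norm_num
    · intro u hu
      rw [Function.mem_support] at hu
      simp only [Finset.coe_insert, Finset.coe_singleton, Set.mem_insert_iff, Set.mem_singleton_iff]
      by_contra hcon
      push Not at hcon
      apply hu
      rw [if_neg]
      rintro (e | e)
      · apply hcon.1; apply Subtype.ext; simp [u₁, e]
      · apply hcon.2; apply Subtype.ext; simp [u₂, e]
  · rw [if_neg (fun hc ↦ hm (hcoset.mp hc)), mul_zero]
    apply finsum_eq_zero_of_forall_eq_zero
    intro u
    rw [if_neg]
    rintro (e | e)
    · apply hm; rw [e]; simp
    · apply hm
      rw [show h * g⁻¹ = -(u : SL(2, ℤ)) by rw [e]; simp]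
      exact (neg_mem_Gamma0_iff _).mpr u.2

/-- The support of `u ↦ [h = ±ug]` is finite (at most `u = ±hg⁻¹`). [folklore] -/
theorem finite_support_indicator (h g : SL(2, ℤ)) :
    (Function.support fun u : Gamma0 N ↦ (if (h = (u : SL(2, ℤ)) * g ∨ h = -((u : SL(2, ℤ)) * g)) then (1 : ℤ) else 0)).Finite := by
  apply Set.Finite.subset (((Set.finite_singleton (-(h * g⁻¹))).insert (h * g⁻¹)).preimage
    (Subtype.coe_injective.injOn))
  intro u hu
  rw [Function.mem_support] at hu
  show (u : SL(2, ℤ)) ∈ insert (h * g⁻¹) ({-(h * g⁻¹)} : Set (SL(2, ℤ)))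
  rw [Set.mem_insert_iff, Set.mem_singleton_iff]
  by_contra hcon
  push Not at hcon
  apply hu
  rw [if_neg]
  rintro (e | e)
  · apply hcon.1; rw [e]; simp
  · apply hcon.2; rw [show h * g⁻¹ = -(u : SL(2, ℤ)) by rw [e]; simp]; simp

/-- Swapping a list sum with a finitely supported `finsum`, with the finiteness of the support of the list sum. [folklore] -/
theorem finsum_list_sum_swap {ι : Type} (φ : SL(2, ℤ) → ι → ℤ) (hφ : ∀ h, (Function.support (φ h)).Finite) (E : List SL(2, ℤ)) :
    (Function.support fun u ↦ (E.map fun h ↦ φ h u).sum).Finite ∧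
      ∑ᶠ u, (E.map fun h ↦ φ h u).sum = (E.map fun h ↦ ∑ᶠ u, φ h u).sum := by
  induction E with
  | nil => simp
  | cons h E ih =>
    obtain ⟨ihf, ihs⟩ := ih
    simp only [List.map_cons, List.sum_cons]
    refine ⟨?_, ?_⟩
    · apply Set.Finite.subset ((hφ h).union ihf)
      intro u hu
      rw [Function.mem_support] at hu
      by_contra hcon
      simp only [Set.mem_union, Function.mem_support, not_or, not_not] at hcon
      exact hu (by rw [hcon.1, hcon.2, add_zero])
    · rw [finsum_add_distrib (hφ h) ihf, ihs]

/-- **Side formula (brick HA3).** For a dual walk `E` from the triangle of `k₁` to the triangle of `k₂` and `g ∈ SL₂(ℤ)`: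
`2·vec(E)(g⁻¹Γ₀(N)) = Σ'_{u∈Γ₀(N)} (G₁((ug)⁻¹k₂) − G₁((ug)⁻¹k₁))` — the crossing vector at the class of the edge of `g` counts, over all
translates `ug`, the side change of the end triangles w.r.t. that edge. [cite: Merel1995Homologie, §1.2–1.3] [cite: Manin1972, §1.5] -/
theorem two_mul_dualChainVec_eq_finsum (k₁ k₂ : SL(2, ℤ)) (E : List SL(2, ℤ))
    (hE : ∀ {A : Type} [AddCommGroup A] (G : SL(2, ℤ) → A),
      (∀ x, G (x * (S * T⁻¹)) = G x) → (∀ x, G (-x) = G x) → (E.map fun h ↦ G h - G (h * S)).sum = G k₂ - G k₁)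
    (g : SL(2, ℤ)) :
    2 * (E.map fun h ↦ (Pi.single ((h⁻¹ : SL(2, ℤ)) : Gamma0Coset N) (1 : ℤ) -
      Pi.single (((h * S)⁻¹ : SL(2, ℤ)) : Gamma0Coset N) 1 : Gamma0Coset N → ℤ)).sum ((g⁻¹ : SL(2, ℤ)) : Gamma0Coset N) =
      ∑ᶠ u : Gamma0 N,
        ((if (0 < (((u : SL(2, ℤ)) * g)⁻¹ * k₂) 0 0 * (((u : SL(2, ℤ)) * g)⁻¹ * k₂) 1 0 ∨ 0 < (((u : SL(2, ℤ)) * g)⁻¹ * k₂) 0 1 * (((u : SL(2, ℤ)) * g)⁻¹ * k₂) 1 1 ∨ 0 < ((((u : SL(2, ℤ)) * g)⁻¹ * k₂) 0 0 + (((u : SL(2, ℤ)) * g)⁻¹ * k₂) 0 1) * ((((u : SL(2, ℤ)) * g)⁻¹ * k₂) 1 0 + (((u : SL(2, ℤ)) * g)⁻¹ * k₂) 1 1)) then (1 : ℤ) else 0) -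
         (if (0 < (((u : SL(2, ℤ)) * g)⁻¹ * k₁) 0 0 * (((u : SL(2, ℤ)) * g)⁻¹ * k₁) 1 0 ∨ 0 < (((u : SL(2, ℤ)) * g)⁻¹ * k₁) 0 1 * (((u : SL(2, ℤ)) * g)⁻¹ * k₁) 1 1 ∨ 0 < ((((u : SL(2, ℤ)) * g)⁻¹ * k₁) 0 0 + (((u : SL(2, ℤ)) * g)⁻¹ * k₁) 0 1) * ((((u : SL(2, ℤ)) * g)⁻¹ * k₁) 1 0 + (((u : SL(2, ℤ)) * g)⁻¹ * k₁) 1 1)) then (1 : ℤ) else 0)) := by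
  -- rewrite each summand as the net crossing of `E` with the edge `ug`
  have step : ∀ u : Gamma0 N,
      ((if (0 < (((u : SL(2, ℤ)) * g)⁻¹ * k₂) 0 0 * (((u : SL(2, ℤ)) * g)⁻¹ * k₂) 1 0 ∨ 0 < (((u : SL(2, ℤ)) * g)⁻¹ * k₂) 0 1 * (((u : SL(2, ℤ)) * g)⁻¹ * k₂) 1 1 ∨ 0 < ((((u : SL(2, ℤ)) * g)⁻¹ * k₂) 0 0 + (((u : SL(2, ℤ)) * g)⁻¹ * k₂) 0 1) * ((((u : SL(2, ℤ)) * g)⁻¹ * k₂) 1 0 + (((u : SL(2, ℤ)) * g)⁻¹ * k₂) 1 1)) then (1 : ℤ) else 0) -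
       (if (0 < (((u : SL(2, ℤ)) * g)⁻¹ * k₁) 0 0 * (((u : SL(2, ℤ)) * g)⁻¹ * k₁) 1 0 ∨ 0 < (((u : SL(2, ℤ)) * g)⁻¹ * k₁) 0 1 * (((u : SL(2, ℤ)) * g)⁻¹ * k₁) 1 1 ∨ 0 < ((((u : SL(2, ℤ)) * g)⁻¹ * k₁) 0 0 + (((u : SL(2, ℤ)) * g)⁻¹ * k₁) 0 1) * ((((u : SL(2, ℤ)) * g)⁻¹ * k₁) 1 0 + (((u : SL(2, ℤ)) * g)⁻¹ * k₁) 1 1)) then (1 : ℤ) else 0)) =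
      (E.map fun h ↦ ((if (h = (u : SL(2, ℤ)) * g ∨ h = -((u : SL(2, ℤ)) * g)) then (1 : ℤ) else 0) -
        (if (h * S = (u : SL(2, ℤ)) * g ∨ h * S = -((u : SL(2, ℤ)) * g)) then (1 : ℤ) else 0))).sum :=
    fun u ↦ (dualChain_netCrossing_eq k₁ k₂ E hE ((u : SL(2, ℤ)) * g)).symm
  simp_rw [step]
  have hswap := finsum_list_sum_swap
    (fun h (u : Gamma0 N) ↦ ((if (h = (u : SL(2, ℤ)) * g ∨ h = -((u : SL(2, ℤ)) * g)) then (1 : ℤ) else 0) -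
      (if (h * S = (u : SL(2, ℤ)) * g ∨ h * S = -((u : SL(2, ℤ)) * g)) then (1 : ℤ) else 0)))
    (fun h ↦ by
      apply Set.Finite.subset ((finite_support_indicator (N := N) h g).union (finite_support_indicator (N := N) (h * S) g))
      intro u hu
      rw [Function.mem_support] at hu
      by_contra hcon
      simp only [Set.mem_union, Function.mem_support, not_or, not_not] at hcon
      exact hu (by rw [hcon.1, hcon.2, sub_zero])) E
  rw [hswap.2, dualChainVec_apply, ← List.sum_map_mul_left]
  congr 1
  refine List.map_congr_left fun h _ ↦ ?_
  rw [finsum_sub_distrib (finite_support_indicator (N := N) h g) (finite_support_indicator (N := N) (h * S) g),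
    finsum_indicator_eq, finsum_indicator_eq]
  ring

/-- **Finiteness of the support of the side difference**: only finitely many translates `ug`, `u ∈ Γ₀(N)`, of the edge of `g` separate the
triangle of `k₁` from the triangle of `k₂` (those met by a dual walk between them). [cite: Manin1972, §1.5] -/
theorem finite_support_sideDiff (k₁ k₂ : SL(2, ℤ)) (E : List SL(2, ℤ))
    (hE : ∀ {A : Type} [AddCommGroup A] (G : SL(2, ℤ) → A),
      (∀ x, G (x * (S * T⁻¹)) = G x) → (∀ x, G (-x) = G x) → (E.map fun h ↦ G h - G (h * S)).sum = G k₂ - G k₁)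
    (g : SL(2, ℤ)) :
    (Function.support fun u : Gamma0 N ↦
        ((if (0 < (((u : SL(2, ℤ)) * g)⁻¹ * k₂) 0 0 * (((u : SL(2, ℤ)) * g)⁻¹ * k₂) 1 0 ∨ 0 < (((u : SL(2, ℤ)) * g)⁻¹ * k₂) 0 1 * (((u : SL(2, ℤ)) * g)⁻¹ * k₂) 1 1 ∨ 0 < ((((u : SL(2, ℤ)) * g)⁻¹ * k₂) 0 0 + (((u : SL(2, ℤ)) * g)⁻¹ * k₂) 0 1) * ((((u : SL(2, ℤ)) * g)⁻¹ * k₂) 1 0 + (((u : SL(2, ℤ)) * g)⁻¹ * k₂) 1 1)) then (1 : ℤ) else 0) -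
         (if (0 < (((u : SL(2, ℤ)) * g)⁻¹ * k₁) 0 0 * (((u : SL(2, ℤ)) * g)⁻¹ * k₁) 1 0 ∨ 0 < (((u : SL(2, ℤ)) * g)⁻¹ * k₁) 0 1 * (((u : SL(2, ℤ)) * g)⁻¹ * k₁) 1 1 ∨ 0 < ((((u : SL(2, ℤ)) * g)⁻¹ * k₁) 0 0 + (((u : SL(2, ℤ)) * g)⁻¹ * k₁) 0 1) * ((((u : SL(2, ℤ)) * g)⁻¹ * k₁) 1 0 + (((u : SL(2, ℤ)) * g)⁻¹ * k₁) 1 1)) then (1 : ℤ) else 0))).Finite := by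
  have step : ∀ u : Gamma0 N,
      ((if (0 < (((u : SL(2, ℤ)) * g)⁻¹ * k₂) 0 0 * (((u : SL(2, ℤ)) * g)⁻¹ * k₂) 1 0 ∨ 0 < (((u : SL(2, ℤ)) * g)⁻¹ * k₂) 0 1 * (((u : SL(2, ℤ)) * g)⁻¹ * k₂) 1 1 ∨ 0 < ((((u : SL(2, ℤ)) * g)⁻¹ * k₂) 0 0 + (((u : SL(2, ℤ)) * g)⁻¹ * k₂) 0 1) * ((((u : SL(2, ℤ)) * g)⁻¹ * k₂) 1 0 + (((u : SL(2, ℤ)) * g)⁻¹ * k₂) 1 1)) then (1 : ℤ) else 0) -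
       (if (0 < (((u : SL(2, ℤ)) * g)⁻¹ * k₁) 0 0 * (((u : SL(2, ℤ)) * g)⁻¹ * k₁) 1 0 ∨ 0 < (((u : SL(2, ℤ)) * g)⁻¹ * k₁) 0 1 * (((u : SL(2, ℤ)) * g)⁻¹ * k₁) 1 1 ∨ 0 < ((((u : SL(2, ℤ)) * g)⁻¹ * k₁) 0 0 + (((u : SL(2, ℤ)) * g)⁻¹ * k₁) 0 1) * ((((u : SL(2, ℤ)) * g)⁻¹ * k₁) 1 0 + (((u : SL(2, ℤ)) * g)⁻¹ * k₁) 1 1)) then (1 : ℤ) else 0)) =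
      (E.map fun h ↦ ((if (h = (u : SL(2, ℤ)) * g ∨ h = -((u : SL(2, ℤ)) * g)) then (1 : ℤ) else 0) -
        (if (h * S = (u : SL(2, ℤ)) * g ∨ h * S = -((u : SL(2, ℤ)) * g)) then (1 : ℤ) else 0))).sum :=
    fun u ↦ (dualChain_netCrossing_eq k₁ k₂ E hE ((u : SL(2, ℤ)) * g)).symm
  simp_rw [step]
  exact (finsum_list_sum_swap
    (fun h (u : Gamma0 N) ↦ ((if (h = (u : SL(2, ℤ)) * g ∨ h = -((u : SL(2, ℤ)) * g)) then (1 : ℤ) else 0) -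
      (if (h * S = (u : SL(2, ℤ)) * g ∨ h * S = -((u : SL(2, ℤ)) * g)) then (1 : ℤ) else 0)))
    (fun h ↦ by
      apply Set.Finite.subset ((finite_support_indicator (N := N) h g).union (finite_support_indicator (N := N) (h * S) g))
      intro u hu
      rw [Function.mem_support] at hu
      by_contra hcon
      simp only [Set.mem_union, Function.mem_support, not_or, not_not] at hcon
      exact hu (by rw [hcon.1, hcon.2, sub_zero])) E).1

end SideFormula

end Summit.BirchSwinnertonDyer.BirchSwinnertonDyer.Theorems.ThetaLayerLambdaCongruenceAtTwo

end
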